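import Literature.Analysis.FluidPDE.AlbrittonBlowupCriterionKato
import Literature.Analysis.FluidPDE.AlbrittonBlowupCriterionPathSpace
import Literature.Analysis.FluidPDE.AlbrittonBlowupCriterionProofs
import HarnessLib

/-!
# Albritton's Corollary 4.6 over Albritton's own class — review of the split child
`albritton_singular_point_of_blowup`

Proof-only sibling (no definition, no named fact; nothing accepted is restated or changed) of
`Literature/Analysis/FluidPDE/AlbrittonBlowupCriterion.lean`, which vendors D. Albritton, *Blow-up
criteria for the Navier–Stokes equations in non-endpoint critical Besov spaces*, Anal. PDE 11 (2018)
1415–1456 = arXiv:1612.04439, **Cor. 4.6** as the named fact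
`Literature.Analysis.FluidPDE.albritton_singular_point_of_blowup` (the decomposition child of
`albritton_besov_blowup`, Thm. 1.1, that survives the review of the split; its sibling
`albritton_regular_of_liminf_besov`, §3 Steps 1–3, was retired as a corollary of the parent, see
`AlbrittonBlowupCriterionProofs.lean`), and of `AlbrittonBlowupCriterionKato.lean`, which
vendors Albritton's uniqueness class (4.52) (`IsKatoBesovMildSolutionOn`,
`IsMaximalKatoBesovMildSolution`). It records, machine-checked, the verdict of the review of that
child (review-split seat, 2026-08-15).

## What is printed and what is vendored

In print (arXiv p. 25): *"Let `u` be the mild solution of Theorem 4.2 with initial data `u₀`. If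
`T*(u₀) < ∞`, then `u` has a singular point at time `T*(u₀)`"*, where (Thm. 4.2, p. 20) `u = NS(u₀)`
is the unique mild solution in the class (4.52) `K̊_p(Q_T) ∩ K̊_∞(Q_T) ∩ C((0,T]; L^p ∩ L^∞)` (and
in the class (4.51)) for all `T < T*(u₀)`, `T*(u₀)` being characterised by (4.53) (i):
`lim_{t ↑ T*} ‖u(t)‖_{L^{p₀}} = ∞` for every `p₀ ∈ [p, ∞]`; singular points as in §4.4.

The vendored child quantifies instead over the tree's class `IsMaximalBesovMildSolution (-1+3/p) p q`
of `CriticalRegularity.lean` (duality-form mild, continuous in `Ḃ^{s_p}_{p,q}`, Kato's class `K̊_∞`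
**only**, no extension *in that class*). Passing from the printed statement to the vendored one
requires the identification "every member of the tree's class lies in Albritton's class (4.52)"
(hypothesis `hId` below) — a uniqueness statement for mild solutions in
`C_t Ḃ^{s_p}_{p,q} ∩ K̊_∞` that is **not** printed by Albritton (both his uniqueness classes carry an
`L^p`-weight, `K̊_p` resp. `L̃¹_T Ḃ^{s_p+2}_{p,q}`) and not published elsewhere (audits in
`GKPCriticalElements.lean`, `GKPRegularityPersistence.lean`, `AlbrittonBlowupCriterionKato.lean`,
`AlbrittonBlowupCriterionPathSpace.lean`). This is the same defect as recorded there for the parent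
`albritton_besov_blowup`; the child inherits it because its quantifier prefix is the parent's (it
was cut to feed the contradiction "every `(T, x₀)` regular vs. some `(T, x₀)` singular" at the
parent's maximal time).

## What this file proves

* `IsMaximalBesovMildSolution.isMaximalKatoBesovMildSolution_of_identification` and its converse
  `IsMaximalKatoBesovMildSolution.isMaximalBesovMildSolution_of_identification`: under `hId` the two
  maximality notions agree.
* `albritton_singular_point_of_blowup_of_katoClass : h → hId → albritton_singular_point_of_blowup` —
  the vendored child **is** Cor. 4.6 over Albritton's class (hypothesis `h`, the corrected statement,
  written out verbatim and *not* vendored here, D-0026) **plus** the identification `hId`; and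
  conversely `katoClass_singular_point_of_albritton_singular_point_of_blowup :
  albritton_singular_point_of_blowup → hId → h`, whence
  `albritton_singular_point_of_blowup_iff_katoClass : hId → (albritton_singular_point_of_blowup ↔ h)`.
* Unconditionally (no `hId`): `albritton_singular_point_of_blowup.exists_singular_of_tendsto_eLpNorm_top`
  — the vendored child yields a singular point at time `T` for every Besov mild solution of the
  tree's class whose `L^∞` norm tends to `∞` as `t ↑ T`, which is what Thm. 4.2 (4.53) (i) prints
  for `NS(u₀)` at `T = T*(u₀) < ∞` (via
  `IsBesovMildSolutionOn.isMaximalBesovMildSolution_of_tendsto_eLpNorm_top`); so the vendored child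
  is at least as strong as Cor. 4.6.
* For the retired sibling (§3, Steps 1–3: a finite `liminf` of the critical norm at `T` rules out
  singular points at time `T`): its Kato-class form is a consequence of the *parent* by projection,
  `albritton_besov_blowup.regular_of_frequently_le_katoClass` (through
  `albritton_besov_blowup.regular_of_frequently_le` of `AlbrittonBlowupCriterionProofs.lean`, which
  proves the tree-class form from `albritton_besov_blowup`); the earlier pair
  `albritton_regular_of_liminf_besov.katoClass` / `albritton_regular_of_liminf_besov_of_katoClass`,
  stated against the retired named fact, went with it.

## References

* D. Albritton, Anal. PDE 11 (2018) 1415–1456 = arXiv:1612.04439: Cor. 4.6 and Prop. 4.5 (p. 25),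
  Thm. 4.2 with (4.52), (4.53) (i) (p. 20–21), §4.4 (singular points, p. 25), §3 (p. 15).
  [cite: Albritton2018, Cor. 4.6]
-/

noncomputable section

open MeasureTheory TemperedDistribution Set Function Filter Metric
open _root_.Topology
open scoped SchwartzMap ENNReal NNReal

namespace Literature.Analysis.FluidPDE

/-! ## The two maximality notions under the identification -/

section Identification

variable {p q : ℝ≥0∞} [Fact (1 ≤ p)] {ν : ℝ}

/-- **Tree-maximal ⇒ maximal in Albritton's class, under the identification.** If every Besov mild
solution of the tree's class `(s_p, p, q)` (any lifespan) lies in Albritton's class (4.52)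
(hypothesis `hId`, the unprinted identification), then a maximal solution of the tree is a maximal
solution of Albritton's class: it lies in the class by `hId`, and an extension in Albritton's class
is in particular an extension in the tree's class (projection
`IsKatoBesovMildSolutionOn.isBesovMildSolutionOn`). (Albritton 2018, Thm. 4.2, Step 4 of its proof:
the maximal time of existence.) [cite: Albritton2018, Thm. 4.2 (maximal time of existence)] -/
theorem IsMaximalBesovMildSolution.isMaximalKatoBesovMildSolution_of_identification
    (hId : ∀ ⦃T : ℝ⦄ ⦃u : ℝ → EuclideanSpace ℝ (Fin 3) → EuclideanSpace ℝ (Fin 3)⦄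
      ⦃U : ℝ → 𝓢'(EuclideanSpace ℝ (Fin 3), EuclideanSpace ℂ (Fin 3))⦄,
      IsBesovMildSolutionOn (-1 + 3 / p.toReal) p q T ν u U → IsKatoBesovMildSolutionOn p q T ν u U)
    {T : ℝ} {u : ℝ → EuclideanSpace ℝ (Fin 3) → EuclideanSpace ℝ (Fin 3)}
    {U : ℝ → 𝓢'(EuclideanSpace ℝ (Fin 3), EuclideanSpace ℂ (Fin 3))}
    (hmax : IsMaximalBesovMildSolution (-1 + 3 / p.toReal) p q T ν u U) :
    IsMaximalKatoBesovMildSolution p q T ν u U where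
  isKatoBesovMildSolutionOn := hId hmax.isBesovMildSolutionOn
  not_extendable := by
    rintro ⟨T', hT', v, V, hv, hvu⟩
    exact hmax.not_extendable ⟨T', hT', v, V, hv.isBesovMildSolutionOn, hvu⟩

/-- **Maximal in Albritton's class ⇒ tree-maximal, under the identification.** Conversely, under
`hId` an extension in the tree's class is an extension in Albritton's class, so a maximal solution
of Albritton's class is maximal in the tree's sense (its membership in the tree's class is the
projection `IsMaximalKatoBesovMildSolution.isBesovMildSolutionOn`). (Albritton 2018, Thm. 4.2,
Step 4.) [cite: Albritton2018, Thm. 4.2 (maximal time of existence)] -/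
theorem IsMaximalKatoBesovMildSolution.isMaximalBesovMildSolution_of_identification
    (hId : ∀ ⦃T : ℝ⦄ ⦃u : ℝ → EuclideanSpace ℝ (Fin 3) → EuclideanSpace ℝ (Fin 3)⦄
      ⦃U : ℝ → 𝓢'(EuclideanSpace ℝ (Fin 3), EuclideanSpace ℂ (Fin 3))⦄,
      IsBesovMildSolutionOn (-1 + 3 / p.toReal) p q T ν u U → IsKatoBesovMildSolutionOn p q T ν u U)
    {T : ℝ} {u : ℝ → EuclideanSpace ℝ (Fin 3) → EuclideanSpace ℝ (Fin 3)}
    {U : ℝ → 𝓢'(EuclideanSpace ℝ (Fin 3), EuclideanSpace ℂ (Fin 3))}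
    (hmax : IsMaximalKatoBesovMildSolution p q T ν u U) :
    IsMaximalBesovMildSolution (-1 + 3 / p.toReal) p q T ν u U where
  isBesovMildSolutionOn := hmax.isBesovMildSolutionOn
  not_extendable := by
    rintro ⟨T', hT', v, V, hv, hvu⟩
    exact hmax.not_extendable ⟨T', hT', v, V, hId hv, hvu⟩

end Identification

/-! ## The vendored child = Cor. 4.6 over Albritton's class + the identification -/

section SingularPoint

-- `linter.deprecated` is switched off for the next declaration only (and likewise below): it
-- mentions the deprecated (mis-stated, 2026-08-15) tree-class rendering
-- `albritton_singular_point_of_blowup` of Cor. 4.6 (`AlbrittonBlowupCriterion.lean`), whose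
-- faithful form `albritton_singular_point_of_blowup_katoClass` is vendored and proved in
-- `AlbrittonSingularPointKatoClassHolds.lean`.
set_option linter.deprecated false in
/-- **`albritton_singular_point_of_blowup` from Cor. 4.6 over Albritton's class and the
identification.** Hypothesis `h` is Albritton 2018, **Cor. 4.6** as printed, transported to the
tree's vocabulary with the mild solution of Thm. 4.2 and its maximal time rendered by
`IsMaximalKatoBesovMildSolution` (`AlbrittonBlowupCriterionKato.lean`: the tree's Besov mild class
intersected with the uniqueness class (4.52), no extension in that class — by the uniqueness of
Thm. 4.2 in (4.52) and (4.53) (i) this is "`u = NS(u 0)` on `[0, T)` and `T = T*(u 0) < ∞`"):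
*such a solution has a singular point `(T, x₀)`, i.e. `u` is essentially unbounded on every
backward cylinder `Q_r(T, x₀)`, `0 < r`, `r² < T`* (§4.4), for all `3 < p, q < ∞` and — as for
every fact of this family — every viscosity `ν > 0` and function-valued solutions. It is written
out verbatim and is **not** vendored as a named fact here. Hypothesis `hId` is the unprinted
identification of the tree's class with Albritton's. Together: a maximal solution of the tree is
maximal in Albritton's class
(`IsMaximalBesovMildSolution.isMaximalKatoBesovMildSolution_of_identification`), so `h` applies.
[cite: Albritton2018, Cor. 4.6] -/
theorem albritton_singular_point_of_blowup_of_katoClass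
    (h : ∀ ⦃ν : ℝ⦄, 0 < ν → ∀ ⦃p q : ℝ≥0∞⦄ [Fact (1 ≤ p)], 3 < p → p < ∞ → 3 < q → q < ∞ →
      ∀ ⦃T : ℝ⦄, 0 < T → ∀ ⦃u : ℝ → EuclideanSpace ℝ (Fin 3) → EuclideanSpace ℝ (Fin 3)⦄
        ⦃U : ℝ → 𝓢'(EuclideanSpace ℝ (Fin 3), EuclideanSpace ℂ (Fin 3))⦄,
        IsMaximalKatoBesovMildSolution p q T ν u U →
        ∃ x₀ : EuclideanSpace ℝ (Fin 3), ∀ r : ℝ, 0 < r → r ^ 2 < T →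
          eLpNorm (uncurry u) ∞ (volume.restrict (parabolicCylinder r ((T : ℝ), x₀))) = ∞)
    (hId : ∀ ⦃ν : ℝ⦄, 0 < ν → ∀ ⦃p q : ℝ≥0∞⦄ [Fact (1 ≤ p)], 3 < p → p < ∞ → 3 < q → q < ∞ →
      ∀ ⦃T : ℝ⦄ ⦃u : ℝ → EuclideanSpace ℝ (Fin 3) → EuclideanSpace ℝ (Fin 3)⦄
        ⦃U : ℝ → 𝓢'(EuclideanSpace ℝ (Fin 3), EuclideanSpace ℂ (Fin 3))⦄,
        IsBesovMildSolutionOn (-1 + 3 / p.toReal) p q T ν u U →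
          IsKatoBesovMildSolutionOn p q T ν u U) :
    albritton_singular_point_of_blowup := by
  intro ν hν p q _ hp₃ hp hq₃ hq T hT u U hmax
  exact h hν hp₃ hp hq₃ hq hT
    (hmax.isMaximalKatoBesovMildSolution_of_identification (hId hν hp₃ hp hq₃ hq))

-- `linter.deprecated` off for the next declaration only (deprecated tree-class rendering
-- `albritton_singular_point_of_blowup`, see the note above).
set_option linter.deprecated false in
/-- **Conversely, under the identification the vendored child gives back Cor. 4.6 over
Albritton's class**: a maximal solution of Albritton's class is then maximal in the tree's sense
(`IsMaximalKatoBesovMildSolution.isMaximalBesovMildSolution_of_identification`), and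
`albritton_singular_point_of_blowup` applies. (Albritton 2018, Cor. 4.6.) [cite: Albritton2018, Cor. 4.6] -/
theorem katoClass_singular_point_of_albritton_singular_point_of_blowup
    (h1 : albritton_singular_point_of_blowup)
    (hId : ∀ ⦃ν : ℝ⦄, 0 < ν → ∀ ⦃p q : ℝ≥0∞⦄ [Fact (1 ≤ p)], 3 < p → p < ∞ → 3 < q → q < ∞ →
      ∀ ⦃T : ℝ⦄ ⦃u : ℝ → EuclideanSpace ℝ (Fin 3) → EuclideanSpace ℝ (Fin 3)⦄
        ⦃U : ℝ → 𝓢'(EuclideanSpace ℝ (Fin 3), EuclideanSpace ℂ (Fin 3))⦄,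
        IsBesovMildSolutionOn (-1 + 3 / p.toReal) p q T ν u U →
          IsKatoBesovMildSolutionOn p q T ν u U)
    ⦃ν : ℝ⦄ (hν : 0 < ν) ⦃p q : ℝ≥0∞⦄ [Fact (1 ≤ p)] (hp₃ : 3 < p) (hp : p < ∞) (hq₃ : 3 < q)
    (hq : q < ∞) ⦃T : ℝ⦄ (hT : 0 < T) ⦃u : ℝ → EuclideanSpace ℝ (Fin 3) → EuclideanSpace ℝ (Fin 3)⦄
    ⦃U : ℝ → 𝓢'(EuclideanSpace ℝ (Fin 3), EuclideanSpace ℂ (Fin 3))⦄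
    (hmax : IsMaximalKatoBesovMildSolution p q T ν u U) :
    ∃ x₀ : EuclideanSpace ℝ (Fin 3), ∀ r : ℝ, 0 < r → r ^ 2 < T →
      eLpNorm (uncurry u) ∞ (volume.restrict (parabolicCylinder r ((T : ℝ), x₀))) = ∞ :=
  h1 hν hp₃ hp hq₃ hq hT (hmax.isMaximalBesovMildSolution_of_identification (hId hν hp₃ hp hq₃ hq))

-- `linter.deprecated` off for the next declaration only (deprecated tree-class rendering
-- `albritton_singular_point_of_blowup`, see the note above).
set_option linter.deprecated false in
/-- **Under the identification, the vendored child and Cor. 4.6 over Albritton's class are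
equivalent** (`albritton_singular_point_of_blowup_of_katoClass` and
`katoClass_singular_point_of_albritton_singular_point_of_blowup`). Without `hId` only
"vendored ⇒ printed for solutions with `L^∞` blow-up" is available
(`albritton_singular_point_of_blowup.exists_singular_of_tendsto_eLpNorm_top`). (Albritton 2018,
Cor. 4.6 with Thm. 4.2.) [cite: Albritton2018, Cor. 4.6] -/
theorem albritton_singular_point_of_blowup_iff_katoClass
    (hId : ∀ ⦃ν : ℝ⦄, 0 < ν → ∀ ⦃p q : ℝ≥0∞⦄ [Fact (1 ≤ p)], 3 < p → p < ∞ → 3 < q → q < ∞ →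
      ∀ ⦃T : ℝ⦄ ⦃u : ℝ → EuclideanSpace ℝ (Fin 3) → EuclideanSpace ℝ (Fin 3)⦄
        ⦃U : ℝ → 𝓢'(EuclideanSpace ℝ (Fin 3), EuclideanSpace ℂ (Fin 3))⦄,
        IsBesovMildSolutionOn (-1 + 3 / p.toReal) p q T ν u U →
          IsKatoBesovMildSolutionOn p q T ν u U) :
    albritton_singular_point_of_blowup ↔
      ∀ ⦃ν : ℝ⦄, 0 < ν → ∀ ⦃p q : ℝ≥0∞⦄ [Fact (1 ≤ p)], 3 < p → p < ∞ → 3 < q → q < ∞ →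
        ∀ ⦃T : ℝ⦄, 0 < T → ∀ ⦃u : ℝ → EuclideanSpace ℝ (Fin 3) → EuclideanSpace ℝ (Fin 3)⦄
          ⦃U : ℝ → 𝓢'(EuclideanSpace ℝ (Fin 3), EuclideanSpace ℂ (Fin 3))⦄,
          IsMaximalKatoBesovMildSolution p q T ν u U →
          ∃ x₀ : EuclideanSpace ℝ (Fin 3), ∀ r : ℝ, 0 < r → r ^ 2 < T →
            eLpNorm (uncurry u) ∞ (volume.restrict (parabolicCylinder r ((T : ℝ), x₀))) = ∞ :=
  ⟨fun h1 _ hν _ _ _ hp₃ hp hq₃ hq _ hT _ _ hmax =>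
      katoClass_singular_point_of_albritton_singular_point_of_blowup h1 hId hν hp₃ hp hq₃ hq hT hmax,
    fun h => albritton_singular_point_of_blowup_of_katoClass h hId⟩

-- `linter.deprecated` off for the next declaration only (deprecated tree-class rendering
-- `albritton_singular_point_of_blowup`, see the note above).
set_option linter.deprecated false in
/-- **Vendored ⇒ printed, no identification needed in this direction.** Assume the vendored child
`albritton_singular_point_of_blowup`. Let `ν > 0`, `3 < p, q < ∞`, `0 < T`, and let `(u, U)` be a
Besov mild solution of the tree's class `(s_p, p, q)` on `[0, T)` with `‖u(t)‖_{L^∞} → ∞` as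
`t ↑ T` — which is what Thm. 4.2 (4.53) (i) (`p₀ = ∞`) prints for `NS(u₀)` at `T = T*(u₀) < ∞`. Then
`(u, U)` is maximal in the tree's sense
(`IsBesovMildSolutionOn.isMaximalBesovMildSolution_of_tendsto_eLpNorm_top`: an extension would lie
in `K_∞` past `T` and keep `u` essentially bounded near `T`), so there is a singular point
`(T, x₀)`. Hence the vendored child is at least as strong as Cor. 4.6. [cite: Albritton2018, Cor. 4.6 (with Thm. 4.2 (i))] -/
theorem albritton_singular_point_of_blowup.exists_singular_of_tendsto_eLpNorm_top
    (h1 : albritton_singular_point_of_blowup) {ν : ℝ} (hν : 0 < ν) {p q : ℝ≥0∞} [Fact (1 ≤ p)]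
    (hp₃ : 3 < p) (hp : p < ∞) (hq₃ : 3 < q) (hq : q < ∞) {T : ℝ} (hT : 0 < T)
    {u : ℝ → EuclideanSpace ℝ (Fin 3) → EuclideanSpace ℝ (Fin 3)}
    {U : ℝ → 𝓢'(EuclideanSpace ℝ (Fin 3), EuclideanSpace ℂ (Fin 3))}
    (hu : IsBesovMildSolutionOn (-1 + 3 / p.toReal) p q T ν u U)
    (hblow : Tendsto (fun t => eLpNorm (u t) ∞ volume) (𝓝[<] T) (𝓝 ∞)) :
    ∃ x₀ : EuclideanSpace ℝ (Fin 3), ∀ r : ℝ, 0 < r → r ^ 2 < T →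
      eLpNorm (uncurry u) ∞ (volume.restrict (parabolicCylinder r ((T : ℝ), x₀))) = ∞ :=
  h1 hν hp₃ hp hq₃ hq hT (hu.isMaximalBesovMildSolution_of_tendsto_eLpNorm_top hT hblow)

end SingularPoint

/-! ## The retired sibling over Albritton's class, from the parent -/

section Regular

-- `linter.deprecated` is switched off for the next declaration only: its hypothesis is the
-- deprecated (mis-stated, 2026-08-15) tree-class rendering `albritton_besov_blowup` of Thm. 1.1
-- (`CriticalRegularity.lean`), kept as such until the faithful `albritton_besov_blowup_pathSpace`
-- is vendored.
set_option linter.deprecated false in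
/-- **The Kato-class form of the retired core statement follows from Theorem 1.1.** Assume the
vendored parent `albritton_besov_blowup` (Albritton 2018, Thm. 1.1). Then a solution of Albritton's
class (4.52) on `[0, T)`, `0 < T` (`IsKatoBesovMildSolutionOn p q`, `3 < p, q < ∞`, `ν > 0`), with
`‖U t‖_{Ḃ^{-1+3/p}_{p,q}} ≤ M` frequently as `t ↑ T` for some finite `M` (hypothesis (3.2) of §3,
`liminf < ∞`) is essentially bounded on some backward cylinder `Q_r(T, x₀)`, `r > 0`, at every
`x₀` — i.e. no point `(T, x₀)` is singular (§4.4). Proof: project to the tree's class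
(`IsKatoBesovMildSolutionOn.isBesovMildSolutionOn`) and apply
`albritton_besov_blowup.regular_of_frequently_le` (`AlbrittonBlowupCriterionProofs.lean`: by
Thm. 1.1 a finite `liminf` at `T` makes `T` non-maximal, and the extension lies in `K_∞` past `T`).
For `p = q` this is the Kato-class form of the retired sibling `albritton_regular_of_liminf_besov`
(§3, Steps 1–3), now obtained from the parent instead. [cite: Albritton2018, Thm. 1.1 and §3 (3.2)] -/
theorem albritton_besov_blowup.regular_of_frequently_le_katoClass (h : albritton_besov_blowup)
    {ν : ℝ} (hν : 0 < ν) {p q : ℝ≥0∞} [Fact (1 ≤ p)] (hp₃ : 3 < p) (hp : p < ∞) (hq₃ : 3 < q)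
    (hq : q < ∞) {T : ℝ} (hT : 0 < T) {u : ℝ → EuclideanSpace ℝ (Fin 3) → EuclideanSpace ℝ (Fin 3)}
    {U : ℝ → 𝓢'(EuclideanSpace ℝ (Fin 3), EuclideanSpace ℂ (Fin 3))}
    (hu : IsKatoBesovMildSolutionOn p q T ν u U)
    (hlim : ∃ M : ℝ≥0, ∃ᶠ t in 𝓝[<] T,
      FunctionSpaces.eHomBesovNorm (-1 + 3 / p.toReal) p q (U t) ≤ M) (x₀ : EuclideanSpace ℝ (Fin 3)) :
    ∃ r : ℝ, 0 < r ∧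
      eLpNorm (uncurry u) ∞ (volume.restrict (parabolicCylinder r ((T : ℝ), x₀))) < ∞ :=
  albritton_besov_blowup.regular_of_frequently_le h hν hp₃ hp hq₃ hq hT hu.isBesovMildSolutionOn hlim x₀

end Regular

end Literature.Analysis.FluidPDE

end
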